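import Literature.NumberTheory.EllipticCurves.FunctionFieldEllipticLContinuationLeavesProofs
import HarnessLib

/-!
# `L(E, s)` of a constant elliptic curve: the continuation does not need the Riemann hypothesis for the base curve

Sibling proof file (D-0014: theorems only, sorry-free) in the provefact decomposition of
`Literature.NumberTheory.EllipticCurves.FunctionField.hasLContinuation` (gen 1), sharpening the
dependency graph recorded in `FunctionFieldEllipticLContinuationLeavesProofs`.

There, for a **constant** elliptic curve `E ≅ E₀ ×_k F` over a global function field `F / 𝔽_q`,
`HasLContinuation W` is derived (`hasLContinuation_of_smul_eq_map`, Ulmer (2011), Lecture 1,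
Exercise 9.2) from Weil's theorem for `F` in the form `IsGenus Fq F g`: `2g` numbers `β_j` with
`N_n = qⁿ + 1 - ∑ β_jⁿ` **and** `|β_j| = √q` (the Riemann hypothesis for curves, Weil 1948). The
Riemann hypothesis enters the printed computation only through the harmless bound
`|β_j q^{-s}| < 1` on `Re s > 3/2` needed to expand `log (1 - β_j αᵢ q^{-s})`; it holds as soon
as `|β_j| ≤ q`. This file re-runs the assembly under that weaker hypothesis:

* `hasProd_inv_one_sub_pow_degree_of_norm_le`: the Euler product of the base curve,
  `∏_v (1 - z^{deg v})⁻¹ = ∏_j (1 - β_j z) / ((1 - z)(1 - qz))` for `|z| < q⁻¹`, from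
  `N_n = qⁿ + 1 - ∑_j β_jⁿ` (`n ≥ 1`) and `|β_j| ≤ q` only (any finite family `β`);
* `ellLFunction_map_const_eq_of_norm_le`, `ellLFunction_eq_div_of_smul_eq_map_of_norm_le`:
  Ulmer's Exercise 9.2, `L(E, s) = ∏_{i,j}(1 - αᵢβ_j q^{-s}) / (∏ᵢ(1 - αᵢq^{-s}) ∏ᵢ(1 - αᵢq^{1-s}))`
  on `Re s > 3/2`, under the same weaker hypothesis (the `αᵢ` of `E₀` do satisfy `|αᵢ| = √q`,
  Hasse's theorem, proved in the tree: `WeierstrassCurve.card_point_baseChange_eq_holds`);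
* `HasLContinuation.of_smul_eq_map_of_weilCount_eq`,
  `hasLContinuation_of_functionField_of_isConstantCurve_of_weilCount_eq`: **for a constant
  elliptic curve, `HasLContinuation W` follows from any "Weil form without the Riemann
  hypothesis"** of `ζ_F` — a finite family `β` with `N_n = qⁿ + 1 - ∑ β_jⁿ` for `n ≥ 1` and
  `|β_j| ≤ q` — with no further input (no `IsFullConstantField`, no named fact). Such a family is
  provided by F. K. Schmidt's rationality theorem `Z_F(u) = L(u)/((1 - u)(1 - qu))`,
  `L(u) = ∏ (1 - β_j u)` (Rosen Thm. 5.9; Stichtenoth Thm. 5.1.15 with Cor. 5.1.16/5.1.17, a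
  consequence of the Riemann–Roch theorem, which is proved in the tree:
  `Literature.NumberTheory.DiophantineGeometry.AlgFunctionField.riemann_roch_holds`) together with
  the absolute convergence of the Euler product on `|u| < q⁻¹` (no zero of `L` there, so
  `|β_j| ≤ q`); it does **not** require Weil's Riemann hypothesis `|β_j| = √q`
  (Stichtenoth Thm. 5.2.1), which is what the leaf `existsUnique_isGenus_of_functionField`
  additionally asserts.
* `HasLContinuation.of_smul_eq_map_of_isGenus`: the old route as the special case `|β_j| = √q ≤ q`.

So in the dependency graph of `hasLContinuation_of_functionField`, the constant case now rests on
F. K. Schmidt's theorem (Riemann–Roch: done; finiteness of the class number, existence of a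
divisor of degree one and the `L`-polynomial: Stichtenoth §5.1, vendored as
`AlgFunctionField.lSeries_eq_polynomial` in `DiophantineGeometry/FunctionFieldZeta`) instead of
the Riemann hypothesis for curves; the non-constant case (Theorem 9.3, Grothendieck–Deligne) is
unchanged.

The proofs are those of `FunctionFieldEllipticLConstantProofs` (`hasProd_inv_one_sub_pow_degree`,
`ellLFunction_map_const_eq`) and `FunctionFieldEllipticLRationality`
(`hasLContinuation_of_smul_eq_map`) with the single estimate `|β_j z| < 1` now taken from
`|β_j| ≤ q`, `|z| < q⁻¹`.

## References

* [Ulmer2011ParkCity] D. Ulmer, *Elliptic curves over function fields*, IAS/Park City Math. Ser. 18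
  (2011), Lecture 0, §3 and Lecture 1, §9, Exercise 9.2 (arXiv:1101.1939, pp. 5, 18).
* [RosenFunctionFields2002] M. Rosen, *Number Theory in Function Fields*, GTM 210, Ch. 5, Thm. 5.9
  (F. K. Schmidt) and Thm. 5.10 (Weil).
* [Stichtenoth2009] H. Stichtenoth, *Algebraic Function Fields and Codes*, 2nd ed., GTM 254, Thm.
  5.1.15, Cor. 5.1.16, Cor. 5.1.17, Thm. 5.2.1.
* [SilvermanAEC2009] J. H. Silverman, *The Arithmetic of Elliptic Curves*, 2nd ed., Thm. V.2.3.1.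
-/

noncomputable section

open scoped Classical Polynomial

open Complex Filter Topology

namespace Literature.NumberTheory.EllipticCurves.FunctionField

variable {F : Type} [Field F]

/-! ## The Euler product of the base curve from an RH-free Weil form -/

section Zeta

variable (Fq : Type) [Field Fq] [Fintype Fq]
variable [Algebra Fq[X] F] [Algebra (RatFunc Fq) F] [IsScalarTower Fq[X] (RatFunc Fq) F]
  [FunctionField Fq F]

/-- **The zeta function of the base curve as an Euler product, without the Riemann hypothesis.**
If `N_n = qⁿ + 1 - ∑ⱼ βⱼⁿ` for all `n ≥ 1` for a finite family `β` with `|βⱼ| ≤ q`, then for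
`|z| < q⁻¹` the Euler product over the places of `F` converges:
`∏_v (1 - z^{deg v})⁻¹ = ∏ⱼ (1 - βⱼ z) / ((1 - z)(1 - q z))` (Ulmer (2011), Lecture 0, §3:
`Z(X, T) = ∏_x (1 - T^{deg x})⁻¹ = exp(∑ N_n Tⁿ/n) = P₁(T)/((1 - T)(1 - qT))`). Same proof as
`hasProd_inv_one_sub_pow_degree` (exponentiate `∑_v -log(1 - z^{deg v}) = ∑_n N_n zⁿ/n =
-log(1 - qz) - log(1 - z) + ∑ⱼ log(1 - βⱼ z)`), the expansion of `log(1 - βⱼ z)` being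
justified by `|βⱼ z| < 1`, i.e. by `|βⱼ| ≤ q` instead of `|βⱼ| = √q`.
[cite: Ulmer2011ParkCity, Lect. 0, §3] -/
theorem hasProd_inv_one_sub_pow_degree_of_norm_le {ι : Type} [Fintype ι] {β : ι → ℂ}
    (hN : ∀ n : ℕ, 0 < n →
      (weilCount Fq F n : ℂ) = (Fintype.card Fq : ℂ) ^ n + 1 - ∑ j, β j ^ n)
    (hβ : ∀ j, ‖β j‖ ≤ (Fintype.card Fq : ℝ)) {z : ℂ} (hz : ‖z‖ < (Fintype.card Fq : ℝ)⁻¹) :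
    HasProd (fun v : Place F => (1 - z ^ v.degree (Fintype.card Fq))⁻¹)
      ((∏ j, (1 - β j * z)) / ((1 - z) * (1 - (Fintype.card Fq : ℂ) * z))) := by
  set q : ℕ := Fintype.card Fq with hq
  set d : Place F → ℕ := fun v => v.degree q with hddef
  have hd : ∀ v, 0 < d v := fun v => Place.degree_pos_of_finiteDimensional Fq v
  have hq1 : (1 : ℝ) < q := by exact_mod_cast (Fintype.one_lt_card : 1 < q)
  have hq0 : (0 : ℝ) < q := zero_lt_one.trans hq1
  set r : ℝ := ‖z‖ with hr
  have hr0 : 0 ≤ r := norm_nonneg z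
  have hrq : r * q < 1 := by rwa [← lt_div_iff₀ hq0, one_div]
  have hr1 : r < 1 := by
    have : (q : ℝ)⁻¹ ≤ 1 := inv_le_one_of_one_le₀ hq1.le
    exact hz.trans_le this
  -- norms of the relevant quantities are `< 1`
  have hzq : ‖(q : ℂ) * z‖ < 1 := by rwa [norm_mul, Complex.norm_natCast, mul_comm]
  have hz1 : ‖z‖ < 1 := hr1
  have hzβ : ∀ j, ‖β j * z‖ < 1 := fun j => by
    rw [norm_mul]
    calc ‖β j‖ * ‖z‖ ≤ q * r := by gcongr; exact hβ j
      _ = r * q := mul_comm _ _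
      _ < 1 := hrq
  have hzd : ∀ v, ‖z ^ d v‖ < 1 := fun v => by
    rw [norm_pow]; exact pow_lt_one₀ hr0 hr1 (hd v).ne'
  -- absolute summability of the double family `A(v, k) = z^{d_v (k+1)}/(k+1)`
  set A : Place F × ℕ → ℂ := fun p => z ^ (d p.1 * (p.2 + 1)) / (p.2 + 1 : ℂ) with hA
  have hAbound : ∀ p : Place F × ℕ, ‖A p‖ ≤ r ^ d p.1 * r ^ p.2 := by
    rintro ⟨v, k⟩
    simp only [hA, norm_div, norm_pow]
    have hk : (1 : ℝ) ≤ ‖(k + 1 : ℂ)‖ := by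
      rw [← Nat.cast_succ, Complex.norm_natCast]; exact_mod_cast Nat.succ_pos k
    calc r ^ (d v * (k + 1)) / ‖(k + 1 : ℂ)‖ ≤ r ^ (d v * (k + 1)) := div_le_self (by positivity) hk
      _ = r ^ d v * r ^ (d v * k) := by rw [mul_add, mul_one, pow_add, mul_comm]
      _ ≤ r ^ d v * r ^ k := by
        gcongr _ * ?_
        exact pow_le_pow_of_le_one hr0 hr1.le (Nat.le_mul_of_pos_left k (hd v))
  have hsum_r : Summable fun v : Place F => r ^ d v := summable_pow_degree Fq hr0 hz
  have h1 : Summable fun v : Place F => ‖(r ^ d v : ℝ)‖ :=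
    hsum_r.congr fun v => by rw [Real.norm_of_nonneg (pow_nonneg hr0 _)]
  have h2 : Summable fun k : ℕ => ‖(r ^ k : ℝ)‖ := by
    simpa [Real.norm_of_nonneg (pow_nonneg hr0 _)] using summable_geometric_of_lt_one hr0 hr1
  have hg : Summable fun p : Place F × ℕ => r ^ d p.1 * r ^ p.2 :=
    summable_mul_of_summable_norm (f := fun v : Place F => r ^ d v) (g := fun k : ℕ => r ^ k) h1 h2
  have hA_summable : Summable A := Summable.of_norm_bounded hg hAbound
  -- regrouping: `∑_{v,k} A = ∑_n N_n zⁿ / n`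
  set S : ℕ → Finset (Place F) := fun n =>
    if hn : 0 < n then (finite_setOf_degree_dvd Fq (F := F) hn).toFinset else ∅ with hSdef
  have hS : ∀ n, 0 < n → ∀ v, v ∈ S n ↔ d v ∣ n := fun n hn v => by
    simp only [hSdef, hn, dite_true, Set.Finite.mem_toFinset, Set.mem_setOf_eq]
    rfl
  have hregroup := hasSum_regroup_dvd d hd z hA_summable S hS
  have hW : ∀ n, (∑ v ∈ S n, (d v : ℂ)) * z ^ n / n = (weilCount Fq F n : ℂ) * z ^ n / n := by
    intro n
    rcases Nat.eq_zero_or_pos n with rfl | hn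
    · simp
    · rw [weilCount_eq_sum Fq hn]
      simp only [hSdef, hn, dite_true, Nat.cast_sum]
      rfl
  simp only [hW] at hregroup
  -- `∑_n N_n zⁿ / n = -log(1 - qz) - log(1 - z) + ∑_j log(1 - β_j z)`
  have hlog : HasSum (fun n : ℕ => (weilCount Fq F n : ℂ) * z ^ n / n)
      (-Complex.log (1 - q * z) + -Complex.log (1 - z) - ∑ j, -Complex.log (1 - β j * z)) := by
    have h1 := Complex.hasSum_taylorSeries_neg_log hzq
    have h2 := Complex.hasSum_taylorSeries_neg_log hz1
    have h3 : HasSum (fun n : ℕ => ∑ j, (β j * z) ^ n / n) (∑ j, -Complex.log (1 - β j * z)) :=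
      hasSum_sum fun j _ => Complex.hasSum_taylorSeries_neg_log (hzβ j)
    refine ((h1.add h2).sub h3).congr_fun fun n => ?_
    rcases Nat.eq_zero_or_pos n with rfl | hn
    · simp
    · rw [hN n hn]
      simp only [mul_pow, sub_mul, add_mul, one_mul, Finset.sum_mul, sub_div, add_div,
        Finset.sum_div]
  have hAsum : ∑' p, A p =
      -Complex.log (1 - q * z) + -Complex.log (1 - z) - ∑ j, -Complex.log (1 - β j * z) :=
    hregroup.unique hlog
  -- summing over `k` first: `∑_k A(v, k) = -log(1 - z^{deg v})`
  have hfiber : HasSum (fun v : Place F => -Complex.log (1 - z ^ d v)) (∑' p, A p) := by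
    refine hA_summable.hasSum.prod_fiberwise fun v => ?_
    have := hasSum_pow_succ_div_neg_log (hzd v)
    simpa only [hA, pow_mul] using this
  -- exponentiate
  have hexp := hfiber.cexp
  rw [hAsum] at hexp
  convert hexp using 1
  · ext v
    simp only [Function.comp_apply, Complex.exp_neg]
    rw [Complex.exp_log]
    exact sub_ne_zero.mpr (fun h => (hzd v).ne (by rw [← h, norm_one]))
  · rw [Complex.exp_sub, Complex.exp_add, Complex.exp_neg, Complex.exp_neg, Complex.exp_sum]
    simp only [Complex.exp_neg]
    have hne1 : (1 : ℂ) - q * z ≠ 0 :=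
      sub_ne_zero.mpr (fun h => hzq.ne (by rw [← h, norm_one]))
    have hne2 : (1 : ℂ) - z ≠ 0 := sub_ne_zero.mpr (fun h => hz1.ne (by rw [← h, norm_one]))
    have hne3 : ∀ j, (1 : ℂ) - β j * z ≠ 0 := fun j =>
      sub_ne_zero.mpr (fun h => (hzβ j).ne (by rw [← h, norm_one]))
    rw [Complex.exp_log hne1, Complex.exp_log hne2]
    simp only [Complex.exp_log (hne3 _)]
    rw [Finset.prod_inv_distrib, div_inv_eq_mul, div_eq_iff (mul_ne_zero hne2 hne1)]
    field_simp [hne1, hne2]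
    have hne1' : (1 : ℂ) - z * q ≠ 0 := by rwa [mul_comm] at hne1
    rw [mul_div_cancel_left₀ _ hne1']
    exact Finset.prod_congr rfl fun j _ => by ring

/-- The Riemann-hypothesis form is the special case `|βⱼ| = √q ≤ q` (sanity check:
`hasProd_inv_one_sub_pow_degree` of `FunctionFieldEllipticLConstantProofs` follows from the
RH-free version). [cite: Ulmer2011ParkCity, Lect. 0, §3] -/
theorem norm_le_card_of_norm_eq_sqrt {β : ℂ} (hβ : ‖β‖ = √(Fintype.card Fq : ℝ)) :
    ‖β‖ ≤ (Fintype.card Fq : ℝ) := by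
  have hq1 : (1 : ℝ) ≤ Fintype.card Fq := by exact_mod_cast (Fintype.one_lt_card).le
  have hq0 : (0 : ℝ) ≤ Fintype.card Fq := zero_le_one.trans hq1
  rw [hβ, Real.sqrt_le_left hq0]
  nlinarith

end Zeta

/-! ## Exercise 9.2 and the continuation of `L(E, s)` for constant `E`, RH-free -/

section ConstantGlobal

variable (Fq : Type) [Field Fq] [Fintype Fq]
variable [Algebra Fq[X] F] [Algebra (RatFunc Fq) F] [IsScalarTower Fq[X] (RatFunc Fq) F]
  [FunctionField Fq F]

variable (W₀ : WeierstrassCurve Fq) [W₀.IsElliptic]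

/-- **Ulmer (2011), Lecture 1, Exercise 9.2 for the constant model `E₀ ×_k F`, RH-free in the
base curve**: with the Frobenius roots `αᵢ` of `E₀` (`#E₀(K) = q^{[K:𝔽_q]} + 1 - ∑ αᵢ^{[K:𝔽_q]}`,
`α₁α₂ = q`, `|αᵢ| = √q`) and any finite family `β` with `N_n = qⁿ + 1 - ∑ βⱼⁿ` (`n ≥ 1`) and
`|βⱼ| ≤ q`, for `Re s > 3/2`:
`L(E₀ ×_k F, s) = ∏_{i,j} (1 - αᵢ βⱼ q^{-s}) / (∏ᵢ (1 - αᵢ q^{-s}) ∏ᵢ (1 - αᵢ q^{1-s}))`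
(`L(E₀ ×_k F, T) = Z(𝒞, α₁T) Z(𝒞, α₂T)` by `localLFactor_map_const` and
`hasProd_inv_one_sub_pow_degree_of_norm_le`). [cite: Ulmer2011ParkCity, Lect. 1, Exercise 9.2] -/
theorem ellLFunction_map_const_eq_of_norm_le {ι : Type} [Fintype ι] {α : Fin 2 → ℂ} {β : ι → ℂ}
    (hα : ∀ (K : Type) [Field K] [Fintype K] [Algebra Fq K],
      (Nat.card (W₀.baseChange K).toAffine.Point : ℂ) =
        (Fintype.card Fq : ℂ) ^ Module.finrank Fq K + 1 - ∑ i, α i ^ Module.finrank Fq K)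
    (hprod : α 0 * α 1 = Fintype.card Fq) (hαn : ∀ i, ‖α i‖ = √(Fintype.card Fq : ℝ))
    (hN : ∀ n : ℕ, 0 < n →
      (weilCount Fq F n : ℂ) = (Fintype.card Fq : ℂ) ^ n + 1 - ∑ j, β j ^ n)
    (hβ : ∀ j, ‖β j‖ ≤ (Fintype.card Fq : ℝ)) {s : ℂ} (hs : (3 / 2 : ℝ) < s.re) :
    ellLFunction (W₀.map ((algebraMap Fq[X] F).comp Polynomial.C)) s =
      (∏ i, ∏ j, (1 - α i * β j * (Fintype.card Fq : ℂ) ^ (-s))) /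
        ((∏ i, (1 - α i * (Fintype.card Fq : ℂ) ^ (-s))) *
          ∏ i, (1 - α i * (Fintype.card Fq : ℂ) ^ (1 - s))) := by
  set q : ℕ := Fintype.card Fq with hq
  set T : ℂ := (q : ℂ) ^ (-s) with hT
  have hq1 : 1 < q := Fintype.one_lt_card
  have hq0 : (q : ℂ) ≠ 0 := Nat.cast_ne_zero.mpr (zero_lt_one.trans hq1).ne'
  -- each `Z(𝒞, αᵢ T)` as an Euler product over places
  have hZ : ∀ i, HasProd (fun v : Place F => (1 - (α i * T) ^ v.degree q)⁻¹)
      ((∏ j, (1 - β j * (α i * T))) / ((1 - α i * T) * (1 - (q : ℂ) * (α i * T)))) := fun i =>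
    hasProd_inv_one_sub_pow_degree_of_norm_le Fq hN hβ (norm_mul_cpow_neg_lt hq1 (hαn i) hs)
  have hL : HasProd (fun v : Place F => localLFactor (W₀.map ((algebraMap Fq[X] F).comp
      Polynomial.C)) v s) (∏ i, (∏ j, (1 - β j * (α i * T))) /
        ((1 - α i * T) * (1 - (q : ℂ) * (α i * T)))) := by
    have := hasProd_prod (s := (Finset.univ : Finset (Fin 2))) fun i _ => hZ i
    refine this.congr_fun fun v => ?_
    rw [localLFactor_map_const Fq W₀ v s hα hprod, ← Finset.prod_inv_distrib]
  rw [ellLFunction, hL.tprod_eq]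
  -- algebra: `q · (αᵢ T) = αᵢ q^{1-s}`
  have hqT : (q : ℂ) ^ (1 - s) = q * T := by
    rw [hT, sub_eq_add_neg, Complex.cpow_add _ _ hq0, Complex.cpow_one]
  rw [Finset.prod_div_distrib, Finset.prod_mul_distrib, hqT]
  congr 1
  · exact Finset.prod_congr rfl fun i _ => Finset.prod_congr rfl fun j _ => by ring
  · congr 1
    exact Finset.prod_congr rfl fun i _ => by ring

variable {W₀} in
/-- Exercise 9.2 (RH-free in the base curve) for every model `W` with `e • W = W₀ ⊗_k F`
(isomorphism invariance `ellLFunction_smul`). [cite: Ulmer2011ParkCity, Lect. 1, Exercise 9.2] -/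
theorem ellLFunction_eq_div_of_smul_eq_map_of_norm_le {W : WeierstrassCurve F}
    {e : WeierstrassCurve.VariableChange F}
    (he : e • W = W₀.map ((algebraMap Fq[X] F).comp Polynomial.C))
    {ι : Type} [Fintype ι] {α : Fin 2 → ℂ} {β : ι → ℂ}
    (hα : ∀ (K : Type) [Field K] [Fintype K] [Algebra Fq K],
      (Nat.card (W₀.baseChange K).toAffine.Point : ℂ) =
        (Fintype.card Fq : ℂ) ^ Module.finrank Fq K + 1 - ∑ i, α i ^ Module.finrank Fq K)
    (hprod : α 0 * α 1 = Fintype.card Fq) (hαn : ∀ i, ‖α i‖ = √(Fintype.card Fq : ℝ))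
    (hN : ∀ n : ℕ, 0 < n →
      (weilCount Fq F n : ℂ) = (Fintype.card Fq : ℂ) ^ n + 1 - ∑ j, β j ^ n)
    (hβ : ∀ j, ‖β j‖ ≤ (Fintype.card Fq : ℝ)) {s : ℂ} (hs : (3 / 2 : ℝ) < s.re) :
    ellLFunction W s =
      (∏ i, ∏ j, (1 - α i * β j * (Fintype.card Fq : ℂ) ^ (-s))) /
        ((∏ i, (1 - α i * (Fintype.card Fq : ℂ) ^ (-s))) *
          ∏ i, (1 - α i * (Fintype.card Fq : ℂ) ^ (1 - s))) := by
  haveI : W.IsElliptic := isElliptic_of_smul_eq_map_of_isElliptic Fq he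
  rw [← ellLFunction_smul W e, he]
  exact ellLFunction_map_const_eq_of_norm_le Fq W₀ hα hprod hαn hN hβ hs

variable {W₀} in
omit [W₀.IsElliptic] in
/-- **Continuation of `L(E, s)` for a constant elliptic curve from an RH-free Weil form of
`ζ_F`.** Let `E` be an elliptic curve over the global function field `F / 𝔽_q` with
`e • W = W₀ ⊗ F` (constant), and let `β` be any finite family of complex numbers with
`N_n = qⁿ + 1 - ∑ⱼ βⱼⁿ` for all `n ≥ 1` and `|βⱼ| ≤ q` (as supplied by F. K. Schmidt's
rationality theorem, Rosen Thm. 5.9 / Stichtenoth Thm. 5.1.15 with Cor. 5.1.16 — no Riemann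
hypothesis). Then `HasLContinuation W`: the rational function of Exercise 9.2 is meromorphic on
`ℂ` and its denominator does not vanish at `s = 1` since `|αᵢ| = √q` (Hasse, for `E₀`, proved:
`WeierstrassCurve.card_point_baseChange_eq_holds`), `1 < √q < q`. Ulmer (2011), Lecture 1, §9:
"in all cases `L(E,s)` is holomorphic at `s = 1`". Relies on: hypotheses `hN`, `hβ` only.
[cite: Ulmer2011ParkCity, Lect. 1, §9, Exercise 9.2] -/
theorem HasLContinuation.of_smul_eq_map_of_weilCount_eq (W : WeierstrassCurve F) [W.IsElliptic]
    {e : WeierstrassCurve.VariableChange F}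
    (he : e • W = W₀.map ((algebraMap Fq[X] F).comp Polynomial.C))
    {ι : Type} [Fintype ι] (β : ι → ℂ)
    (hN : ∀ n : ℕ, 0 < n →
      (weilCount Fq F n : ℂ) = (Fintype.card Fq : ℂ) ^ n + 1 - ∑ j, β j ^ n)
    (hβ : ∀ j, ‖β j‖ ≤ (Fintype.card Fq : ℝ)) : HasLContinuation W := by
  haveI : W₀.IsElliptic := isElliptic_of_smul_eq_map he
  have hHW : W₀.card_point_baseChange_eq := WeierstrassCurve.card_point_baseChange_eq_holds W₀
  obtain ⟨α, α', -, hprod, hα, hα', hcount⟩ := hHW.exists_roots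
  have hq : 1 < Fintype.card Fq := Fintype.one_lt_card
  have hq0 : Fintype.card Fq ≠ 0 := Fintype.card_ne_zero
  set αv : Fin 2 → ℂ := ![α, α'] with hαv
  have hαnorm : ∀ i, ‖αv i‖ = √(Fintype.card Fq : ℝ) := by
    intro i; fin_cases i <;> simp [hαv, hα, hα']
  have hcount' : ∀ (K : Type) [Field K] [Fintype K] [Algebra Fq K],
      (Nat.card (W₀.baseChange K).toAffine.Point : ℂ) =
        (Fintype.card Fq : ℂ) ^ Module.finrank Fq K + 1 - ∑ i, αv i ^ Module.finrank Fq K := by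
    intro K _ _ _
    rw [hcount K, Fin.sum_univ_two]
    simp [hαv]
    ring
  have hprod' : αv 0 * αv 1 = Fintype.card Fq := by simpa [hαv] using hprod
  have hL : ∀ s : ℂ, (3 / 2 : ℝ) < s.re → ellLFunction W s =
      (∏ i, ∏ j, (1 - αv i * β j * (Fintype.card Fq : ℂ) ^ (-s))) /
        ((∏ i, (1 - αv i * (Fintype.card Fq : ℂ) ^ (-s))) *
          ∏ i, (1 - αv i * (Fintype.card Fq : ℂ) ^ (1 - s))) := fun s hs =>
    ellLFunction_eq_div_of_smul_eq_map_of_norm_le Fq he hcount' hprod' hαnorm hN hβ hs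
  refine ⟨_, div_mem_lContinuations_of_differentiable W ?_ ?_ ?_ hL⟩
  · have h : (fun s : ℂ => ∏ i, ∏ j, (1 - αv i * β j * (Fintype.card Fq : ℂ) ^ (-s))) =
        ∏ i, fun s : ℂ => ∏ j, (1 - αv i * β j * (Fintype.card Fq : ℂ) ^ (-s)) := by
      ext s; simp only [Finset.prod_apply]
    rw [h]
    exact Differentiable.finsetProd fun i _ =>
      differentiable_prod_one_sub_mul_cpow_neg Finset.univ (fun j => αv i * β j) hq0
  · exact (differentiable_prod_one_sub_mul_cpow_neg Finset.univ αv hq0).mul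
      (differentiable_prod_one_sub_mul_cpow_one_sub Finset.univ αv hq0)
  · refine mul_ne_zero (Finset.prod_ne_zero_iff.mpr fun i _ => ?_)
      (Finset.prod_ne_zero_iff.mpr fun i _ => ?_)
    · exact (one_sub_ne_zero_of_norm_eq_sqrt hq (hαnorm i)).1
    · exact (one_sub_ne_zero_of_norm_eq_sqrt hq (hαnorm i)).2

/-- The same for every constant elliptic curve (`IsConstantCurve Fq W`).
[cite: Ulmer2011ParkCity, Lect. 1, §9, Exercise 9.2] -/
theorem HasLContinuation.of_isConstantCurve_of_weilCount_eq (W : WeierstrassCurve F)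
    [W.IsElliptic] (hW : IsConstantCurve Fq W) {ι : Type} [Fintype ι] (β : ι → ℂ)
    (hN : ∀ n : ℕ, 0 < n →
      (weilCount Fq F n : ℂ) = (Fintype.card Fq : ℂ) ^ n + 1 - ∑ j, β j ^ n)
    (hβ : ∀ j, ‖β j‖ ≤ (Fintype.card Fq : ℝ)) : HasLContinuation W := by
  obtain ⟨W₀, e, he⟩ := hW
  exact HasLContinuation.of_smul_eq_map_of_weilCount_eq Fq W he β hN hβ

/-- The corrected fact `hasLContinuation_of_functionField Fq W` at a constant curve, from an
RH-free Weil form of `ζ_F`. [cite: Ulmer2011ParkCity, Lect. 1, §9, Exercise 9.2] -/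
theorem hasLContinuation_of_functionField_of_isConstantCurve_of_weilCount_eq
    (W : WeierstrassCurve F) (hW : IsConstantCurve Fq W) {ι : Type} [Fintype ι] (β : ι → ℂ)
    (hN : ∀ n : ℕ, 0 < n →
      (weilCount Fq F n : ℂ) = (Fintype.card Fq : ℂ) ^ n + 1 - ∑ j, β j ^ n)
    (hβ : ∀ j, ‖β j‖ ≤ (Fintype.card Fq : ℝ)) : hasLContinuation_of_functionField Fq W := by
  intro _
  exact HasLContinuation.of_isConstantCurve_of_weilCount_eq Fq W hW β hN hβ

/-- The original `Prop` `hasLContinuation W` (the provefact target) at a constant curve over a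
global function field, from an RH-free Weil form of `ζ_F`.
[cite: Ulmer2011ParkCity, Lect. 1, §9, Exercise 9.2] -/
theorem hasLContinuation_of_isConstantCurve_of_weilCount_eq
    (W : WeierstrassCurve F) (hW : IsConstantCurve Fq W) {ι : Type} [Fintype ι] (β : ι → ℂ)
    (hN : ∀ n : ℕ, 0 < n →
      (weilCount Fq F n : ℂ) = (Fintype.card Fq : ℂ) ^ n + 1 - ∑ j, β j ^ n)
    (hβ : ∀ j, ‖β j‖ ≤ (Fintype.card Fq : ℝ)) : hasLContinuation W :=
  hasLContinuation_of_hasLContinuation_of_functionField Fq W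
    (hasLContinuation_of_functionField_of_isConstantCurve_of_weilCount_eq Fq W hW β hN hβ)

/-- The old route as a special case: `IsGenus Fq F g` (Weil form **with** the Riemann
hypothesis `|βⱼ| = √q`) gives `HasLContinuation` for constant curves with no further hypothesis
(compare `hasLContinuation_of_smul_eq_map`, which also asks for `IsFullConstantField` and the two
named facts now discharged). [cite: Ulmer2011ParkCity, Lect. 1, §9, Exercise 9.2] -/
theorem HasLContinuation.of_isConstantCurve_of_isGenus (W : WeierstrassCurve F) [W.IsElliptic]
    (hW : IsConstantCurve Fq W) {g : ℕ} (hg : IsGenus Fq F g) : HasLContinuation W := by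
  obtain ⟨β, hβ, hN⟩ := hg
  exact HasLContinuation.of_isConstantCurve_of_weilCount_eq Fq W hW β hN
    fun j => norm_le_card_of_norm_eq_sqrt Fq (hβ j)

end ConstantGlobal

end Literature.NumberTheory.EllipticCurves.FunctionField

end
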